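import Literature.NumberTheory.IwasawaTheory.Greenberg2016.DualSelmerCokernelPairing
import Literature.NumberTheory.GaloisRepresentations.TateDualLimitLocalPairingEndomorphism
import Literature.NumberTheory.GaloisRepresentations.ContinuousCohomologyDivisibleSequence
import HarnessLib

/-!
# Greenberg 2010 Prop. 3.2.1, step (β): `S_{𝓛*}(K, T*)` is `Λ`-torsion modulo `Ш¹` when `coker(φ_𝓛)`
# is cotorsion (theorems only)

Topic `NumberTheory/IwasawaTheory/Greenberg2016`; namespace
`Literature.NumberTheory.IwasawaTheory.Greenberg2016`; THEOREMS ONLY (no definition, no named fact,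
no `sorry`, no instance).  Lane «SUR-Λ» of cell `bsd-eis` (road memo `SUR-LAMBDA-ROAD-w5g9.md` §2 ★(β),
brick C5c part 2), `--supports stmt-BirchSwinnertonDyer-19032`.

MATHEMATICS (R. Greenberg, Kyoto J. Math. 50 (2010), proof of Prop. 3.2.1, p. 15): "By proposition
3.1.1, and the assumption about the cokernel of `φ_𝓛` [cotorsion], it follows that `S_{𝓛*}(K, T*)` is a
torsion `Λ`-module [modulo `Ш¹(K, Σ, T*)`]."  In the tree's currency: the map
`y ↦ (t̄ ↦ ∑_{v∈Σ} ⟪t_v, y_v⟫_v)` of `DualSelmerCokernelPairing.lean` is `Λ`-COMPATIBLE —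

  `∑_v ⟪t_v, (r̂ y)_v⟫_v = ∑_v ⟪(r t)_v, y_v⟫_v`   (`globalFunctional_dualEnd`),

`r̂ = E.dualEnd (r • ·)` the scalar of `Λ` on `T*` (the tree's `limitPairing_cohomologyMap_end`, with
`Hmap_localHAddEquiv` and `cohomologyMap_eq_smul_of_forall` identifying `r •` on
`H¹(K_v, 𝐃) = (localRep S ρ v).H 1` with `H¹` of the scalar morphism) — so if `coker(φ_𝓛)` is COTORSION
(the dictionary's `IsCotorsion`, supplied from CRK by the tree's `Specification.isCotorsion_coker_phi_of_crk`)
then the character `Φ(y) ∈ Hom(coker φ_𝓛, ℚ/ℤ)` attached to a family `y_v ∈ L_v^⊥` is killed by some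
`r ∈ Λ⁰`, i.e. `Φ(r̂ y) = 0`, whence `(r̂ y)_v = 0` for all `v ∈ Σ` when `K` is totally complex
(`eq_zero_of_globalFunctional_eq_zero`): **`exists_nonZeroDivisor_dualEnd_local_eq_zero`** — (β).

HONESTY: nothing about SUR, LEO, Prop. 3.2.1's conclusion or BSD is proved here; cotorsion of the
cokernel and the Poitou–Tate inputs are hypotheses.  AI formalisation, weaker than expert review; the
statements are established only by the kernel check.

## References
* R. Greenberg, *Surjectivity of the global-to-local map defining a Selmer group*, Kyoto J. Math.
  50 (2010) 853–888, Prop. 3.1.1, Remark 3.1.2, proof of Prop. 3.2.1 (pp. 14–15). [Greenberg2010]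
* R. Greenberg, *On the structure of Selmer groups*, Springer PROMS 188 (2016), §2.3 (CRK), §2.6.
  [Greenberg2016Selmer]
-/

noncomputable section

open scoped Classical
open Function CategoryTheory NumberField IsDedekindDomain Field
open _root_.TopRep _root_.ContRepresentation _root_.ContinuousCohomology
open Literature.NumberTheory.GaloisRepresentations
open Literature.NumberTheory.GaloisRepresentations.DiscreteGaloisModule
open Literature.NumberTheory.GaloisRepresentations.DiscreteGaloisModule.TorsionLayers
open Literature.NumberTheory.GaloisCohomology (LocalInvariants)
open Literature.AnabelianGeometry.AbsoluteAnabelian.Prop121vii (zmodToQmodZ)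

namespace Literature.NumberTheory.IwasawaTheory.Greenberg2016

variable {K : Type} [Field K] [NumberField K] {S : Set (HeightOneSpectrum (𝓞 K))}
  {Λ : Type} [CommRing Λ] [TopologicalSpace Λ]
  {D : Type} [AddCommGroup D] [Module Λ D] [TopologicalSpace D] [DiscreteTopology D]
  [ContinuousSMul Λ D]
  {ρ : ContinuousRep (GaloisGroupUnramifiedOutside K S) Λ D} {L : Specification S ρ}
  {p : ℕ} [NeZero p] {E : (toGaloisModule S ρ).TorsionLayers p}
  {inv : ∀ k : ℕ, LocalInvariants K (p ^ k)}

/-! ### §1. The scalar `r` on `H¹(K_v, 𝐃)` read on the `Γ_{K_v}`-side -/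

omit [NumberField K] [ContinuousSMul Λ D] in
/-- The scalars of `Λ` commute with the `Γ_K`-action of `toGaloisModule S ρ` (`ρ` is `Λ`-linear).
[cite: Greenberg2016Selmer, §1 p. 3 L15–21] -/
theorem smul_toGaloisModule_apply (r : Λ) (σ : absoluteGaloisGroup K) (d : D) :
    DistribSMul.toAddMonoidHom D r (toGaloisModule S ρ σ d) =
      toGaloisModule S ρ σ (DistribSMul.toAddMonoidHom D r d) := by
  change r • toGaloisModule S ρ σ d = toGaloisModule S ρ σ (r • d)
  rw [toGaloisModule_apply, toGaloisModule_apply, (ρ _).map_smul]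

/-- **`(localHAddEquiv)⁻¹ (r • t) = (r • ·)_* ((localHAddEquiv)⁻¹ t)`**: the scalar `r` on Greenberg's
`H¹(K_v, 𝐃)` is `H¹` of the scalar morphism on the `Γ_{K_v}`-side (`Hmap_localHAddEquiv` +
`cohomologyMap_eq_smul_of_forall`). [cite: Greenberg2016Selmer, §1 p. 3 L15–21] -/
theorem localHAddEquiv_symm_smul (v : Place K) (r : Λ) (t : (localRep S ρ v).H 1) :
    (localHAddEquiv S ρ v 1).symm (r • t) =
      galoisCohomology.map (toGaloisModuleLocalHom S ρ ρ (r • ContinuousLinearMap.id Λ D)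
        (fun g a => ((ρ g).map_smul r a).symm) v) 1 ((localHAddEquiv S ρ v 1).symm t) := by
  haveI : CompactSpace (absoluteGaloisGroup v.Completion) := absoluteGaloisGroup_compactSpace _
  apply (localHAddEquiv S ρ v 1).injective
  rw [AddEquiv.apply_symm_apply, ← Hmap_localHAddEquiv, AddEquiv.apply_symm_apply]
  exact ((localRep S ρ v).cohomologyMap_eq_smul_of_forall r
    (TopRep.ofHom ⟨r • ContinuousLinearMap.id Λ D, fun g => ContinuousLinearMap.ext fun a =>
      (map_smul ((localRep S ρ v).toContRepresentation g) r a).symm⟩)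
    (fun _ => rfl) 1 t).symm

/-! ### §2. `Λ`-compatibility of the functionals -/

/-- **`L_v^⊥` is stable under `r̂`**: if `y_v ∈ L_v^⊥` then `r̂_* y_v ∈ L_v^⊥` (`L_v` is a
`Λ`-submodule and `⟪t, r̂ y⟫ = ⟪r t, y⟫`). [cite: Greenberg2010, §3.1 p. 14] -/
theorem cohomologyMap_mem_dualLocalCondition (hinv : ∀ v : Place K, InvLevelLaw inv v)
    (hΛ : ∀ (r : Λ) (k : ℕ), ∀ d ∈ E.N k, r • d ∈ E.N k) (r : Λ) (v : Place K)
    (Θ' : (E.localDualSystem v).limitRep.toTopRep ⟶ (E.localDualSystem v).limitRep.toTopRep)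
    (hΘ' : ∀ x, Θ'.hom x = E.dualEnd (DistribSMul.toAddMonoidHom D r) (hΛ r) x)
    {yv : continuousCohomology 1 (E.localDualSystem v).limitRep.toTopRep}
    (hyv : yv ∈ E.dualLocalCondition inv v (locCondition S ρ L v)) :
    cohomologyMap Θ' 1 yv ∈ E.dualLocalCondition inv v (locCondition S ρ L v) := by
  rw [TorsionLayers.mem_dualLocalCondition_iff] at hyv ⊢
  intro t ht
  -- `⟪t, r̂ y⟫ = ⟪(r •)_* t, y⟫`
  have hadj := E.limitPairing_cohomologyMap_end (DistribSMul.toAddMonoidHom D r) (hΛ r) inv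
    (smul_toGaloisModule_apply r) v (hinv v)
    (TopRep.ofHom ⟨(toGaloisModuleLocalHom S ρ ρ (r • ContinuousLinearMap.id Λ D)
        (fun g a => ((ρ g).map_smul r a).symm) v).toContinuousLinearMap,
      (toGaloisModuleLocalHom S ρ ρ (r • ContinuousLinearMap.id Λ D)
        (fun g a => ((ρ g).map_smul r a).symm) v).isIntertwining'⟩)
    (fun _ => rfl) Θ' hΘ' t yv
  rw [← limitPairing_apply (hinv v), ← hadj, limitPairing_apply]
  refine hyv _ ?_
  -- `(r •)_* t ∈ L_v`: read `t = (localHAddEquiv)⁻¹ s` with `s ∈ L v`, a `Λ`-submodule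
  obtain ⟨s, rfl⟩ : ∃ s, (localHAddEquiv S ρ v 1).symm s = t :=
    ⟨localHAddEquiv S ρ v 1 t, (localHAddEquiv S ρ v 1).symm_apply_apply t⟩
  rw [mem_locCondition_iff, AddEquiv.apply_symm_apply] at ht
  have hs : (localHAddEquiv S ρ v 1).symm (r • s) = cohomologyMap (TopRep.ofHom
      ⟨(toGaloisModuleLocalHom S ρ ρ (r • ContinuousLinearMap.id Λ D)
          (fun g a => ((ρ g).map_smul r a).symm) v).toContinuousLinearMap,
        (toGaloisModuleLocalHom S ρ ρ (r • ContinuousLinearMap.id Λ D)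
          (fun g a => ((ρ g).map_smul r a).symm) v).isIntertwining'⟩ :
      ((toGaloisModule S ρ).toLocal v).toTopRep ⟶ ((toGaloisModule S ρ).toLocal v).toTopRep) 1
      ((localHAddEquiv S ρ v 1).symm s) :=
    localHAddEquiv_symm_smul v r s
  rw [← hs, mem_locCondition_iff, AddEquiv.apply_symm_apply]
  exact (L v).smul_mem r ht

/-- **`∑_v ⟪t_v, (r̂ y)_v⟫_v = ∑_v ⟪(r t)_v, y_v⟫_v`**: the global functional of `r̂ y` is the global
functional of `y` precomposed with the scalar `r` on `Q_𝓛(K, 𝐃)` (Greenberg: (9) "is a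
nondegenerate `Λ`-pairing"). [cite: Greenberg2010, §3.1 p. 14] -/
theorem globalFunctional_dualEnd [Finite (SigmaPlace S)] (hinv : ∀ v : Place K, InvLevelLaw inv v)
    (hΛ : ∀ (r : Λ) (k : ℕ), ∀ d ∈ E.N k, r • d ∈ E.N k) (r : Λ)
    (Θ' : ∀ v : SigmaPlace S,
      (E.localDualSystem v.1).limitRep.toTopRep ⟶ (E.localDualSystem v.1).limitRep.toTopRep)
    (hΘ' : ∀ (v : SigmaPlace S) x,
      (Θ' v).hom x = E.dualEnd (DistribSMul.toAddMonoidHom D r) (hΛ r) x)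
    (yloc : ∀ v : SigmaPlace S, continuousCohomology 1 (E.localDualSystem v.1).limitRep.toTopRep)
    (hyL : ∀ v : SigmaPlace S, yloc v ∈ E.dualLocalCondition inv v.1 (locCondition S ρ L v.1))
    (q : L.QGlobal) :
    globalFunctional hinv (fun v => cohomologyMap (Θ' v) 1 (yloc v))
        (fun v => cohomologyMap_mem_dualLocalCondition hinv hΛ r v.1 (Θ' v) (hΘ' v) (hyL v)) q =
      globalFunctional hinv yloc hyL (r • q) := by
  rw [globalFunctional_apply, globalFunctional_apply]
  refine Finset.sum_congr rfl fun v _ => ?_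
  obtain ⟨t, ht⟩ := (L v.1).mkQ_surjective (q v)
  rw [Pi.smul_apply, ← ht, Submodule.mkQ_apply, ← Submodule.Quotient.mk_smul, localFunctional_mk,
    localFunctional_mk, localHAddEquiv_symm_smul]
  exact (E.limitPairing_cohomologyMap_end (DistribSMul.toAddMonoidHom D r) (hΛ r) inv
    (smul_toGaloisModule_apply r) v.1 (hinv v.1)
    (TopRep.ofHom ⟨(toGaloisModuleLocalHom S ρ ρ (r • ContinuousLinearMap.id Λ D)
        (fun g a => ((ρ g).map_smul r a).symm) v.1).toContinuousLinearMap,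
      (toGaloisModuleLocalHom S ρ ρ (r • ContinuousLinearMap.id Λ D)
        (fun g a => ((ρ g).map_smul r a).symm) v.1).isIntertwining'⟩)
    (fun _ => rfl) (Θ' v) (hΘ' v) _ _).symm

/-! ### §3. (β): a cotorsion cokernel forces `r̂ y ∈ Ш¹` for some `r ∈ Λ⁰` -/

/-- The Pontryagin dual `Hom(coker φ_𝓛, ℚ/ℤ)` with its natural `Λ`-action `(r·f)(s̄) = f(r·s̄)` is a dual
datum of `coker(φ_𝓛)` in the dictionary's sense. [cite: Greenberg2016Selmer, §1 p. 2 L17–35] -/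
theorem isDualPairing_characterModule_coker :
    IsDualPairing Λ (L.QGlobal ⧸ LinearMap.range L.phi)
      (AddMonoidHom.id (CharacterModule (L.QGlobal ⧸ LinearMap.range L.phi))) :=
  ⟨bijective_id, fun _ _ _ => rfl⟩

/-- **(β) for one family of local classes** (Greenberg 2010, proof of Prop. 3.2.1: cotorsion of
`coker(φ_𝓛)` makes the image of `S_{𝓛*}(K, T*)` in `coker(φ_𝓛)^∨` a torsion `Λ`-module): if
`coker(φ_𝓛)` is cotorsion, the `inv k` are perfect at the finite places, `K` is totally complex and the
global functional of `(y_v)_v` (`y_v ∈ L_v^⊥`) kills `im φ_𝓛`, then for some non-zero-divisor `r ∈ Λ`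
ALL the local classes `(r̂ y)_v`, `v ∈ Σ`, vanish — i.e. `r̂ y ∈ Ш¹(K, Σ, T*)` for a global `y`.
[cite: Greenberg2010, proof of Prop. 3.2.1 (p. 15 L19–25)] [cite: Greenberg2010, Remark 3.1.2 (p. 15)] -/
theorem exists_nonZeroDivisor_dualEnd_local_eq_zero [IsTotallyComplex K] [Finite (SigmaPlace S)]
    (hinv : ∀ v : Place K, InvLevelLaw inv v)
    (hΛ : ∀ (r : Λ) (k : ℕ), ∀ d ∈ E.N k, r • d ∈ E.N k) (hcot : IsCotorsion Λ (L.QGlobal ⧸ LinearMap.range L.phi)) (hperf : ∀ k, (inv k).IsPerfect)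
    (Θ' : ∀ (r : Λ) (v : SigmaPlace S),
      (E.localDualSystem v.1).limitRep.toTopRep ⟶ (E.localDualSystem v.1).limitRep.toTopRep)
    (hΘ' : ∀ (r : Λ) (v : SigmaPlace S) x,
      (Θ' r v).hom x = E.dualEnd (DistribSMul.toAddMonoidHom D r) (hΛ r) x)
    (yloc : ∀ v : SigmaPlace S, continuousCohomology 1 (E.localDualSystem v.1).limitRep.toTopRep)
    (hyL : ∀ v : SigmaPlace S, yloc v ∈ E.dualLocalCondition inv v.1 (locCondition S ρ L v.1))
    (hker : ∀ x : ρ.H 1, globalFunctional hinv yloc hyL (L.phi x) = 0) :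
    ∃ r : Λ, r ∈ nonZeroDivisors Λ ∧ ∀ v : SigmaPlace S, cohomologyMap (Θ' r v) 1 (yloc v) = 0 := by
  -- the character `Φ(y)` of `coker(φ_𝓛)` is killed by a non-zero-divisor `r`
  have htors := hcot (CharacterModule (L.QGlobal ⧸ LinearMap.range L.phi)) (AddMonoidHom.id _)
    isDualPairing_characterModule_coker
  obtain ⟨⟨r, hr⟩, hrf⟩ := @htors (cokerFunctional hinv yloc hyL hker)
  refine ⟨r, hr, fun v => ?_⟩
  -- so the global functional of `r̂ y` vanishes …
  have h0 : globalFunctional hinv (fun v => cohomologyMap (Θ' r v) 1 (yloc v))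
      (fun v => cohomologyMap_mem_dualLocalCondition hinv hΛ r v.1 (Θ' r v) (hΘ' r v) (hyL v)) = 0 := by
    refine AddMonoidHom.ext fun q => ?_
    rw [globalFunctional_dualEnd hinv hΛ r (Θ' r) (hΘ' r) yloc hyL q, AddMonoidHom.zero_apply,
      ← cokerFunctional_mk hinv yloc hyL hker, Submodule.Quotient.mk_smul]
    have h := DFunLike.congr_fun hrf (Submodule.Quotient.mk q)
    rw [Submonoid.mk_smul, CharacterModule.smul_apply] at h
    exact h
  -- … hence every local class of `r̂ y` vanishes (right non-degeneracy; `K` totally complex)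
  exact eq_zero_of_globalFunctional_eq_zero hinv hperf _ _ h0 v

end Literature.NumberTheory.IwasawaTheory.Greenberg2016
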